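import Literature.Topology.FourManifolds.TrisectionsBiCollar
import Literature.Topology.FourManifolds.RegularLevelSplitting
import Mathlib.Analysis.SpecialFunctions.SmoothTransition
import HarnessLib

/-!
# The bevelled sublevel sector `X₁ = {f ≤ a - κ θ}` of a bi-collar and its straightened
# smooth structure with corners along the surface `F`

Topic `Literature/Topology/FourManifolds`; infrastructure for the fact seat
`provefact-Literature.Topology.FourManifolds.exists_isBalancedGKTrisection` (Gay–Kirby 2016,
Thm. 4 via Lemma 14).  Everything in this file is **proved**; no named facts are introduced.

In Gay–Kirby's Lemma 14 the first sector of the trisection is `X₁ = {f ≤ 3/2}`, "the union of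
the `0`-handle and the `1`-handles", and the other two sectors meet it along the two Heegaard
handlebodies of `∂X₁ = H₁₂ ∪_F H₃₁`.  In the corrected predicate
`Literature.Topology.FourManifolds.IsGKTrisection` every sector has a *corner* along the central
surface `F` (a linear image of the model quadrant in a smooth chart), which the smooth domain
`{f ≤ 3/2}` does not have; the sector of the formal construction is therefore the smooth domain
with its boundary **bevelled along `F`**:
`X₁ = {s + κ θ ≤ 0}`, `θ = χ₁(s) χ₂(r) |r|`,
in the bi-collar coordinates `s = f - a`, `r = g - b` of `TrisectionsBiCollar.lean` (`χ₁`, `χ₂`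
smooth bumps equal to `1` near `0`, `κ > 0` small).  Near `F = {s = r = 0}` this is the convex
wedge `{s ≤ -κ |r|} = {-s - κ r ≥ 0, -s + κ r ≥ 0}` (angle slightly less than `π`), away from
the support of `χ₁ χ₂` it is `{f ≤ a}`, and in between its boundary is a smooth hypersurface
transverse to the unit-speed field `U.ξ` of `f`.  This file proves that `X₁` carries the
straightened smooth structure of `TrisectionsSectorAtlas.lean`:

* `Literature.Topology.FourManifolds.BiCollar.BevelData B` — the bumps `χ₁, χ₂`
  (`Literature.Topology.FourManifolds.Bump`, explicit and monotone) and the slope `κ`, with the smallness conditions (`nonempty_bevelData`);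
* `BevelData.θ`, `BevelData.F₁ = s + κ θ` (continuous), the sector `BevelData.sector = {F₁ ≤ 0}`
  (closed, compact, between `{f ≤ a - κ r₂}` and `{f ≤ a}`), the surface
  `BiCollar.surface = F ⊂ X` with `x ∈ F ↔ s x = 0 ∧ r x = 0`;
* on the bi-collar box of radius `εw = min χ₁.rIn χ₂.rIn` the sector is the wedge of the frame
  `BevelData.frame = (-1, -κ; -1, κ)` (`mem_sector_iff_of_mem_box`), so
  `BiCollar.cornerSliceChart` gives corner-slice charts at the points of `F`;
* off `F`, at a point with `F₁ < 0` the translated chart of `X`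
  (`Literature.Topology.FourManifolds.sublevelChartLT'`), and at a boundary point with `F₁ = 0`
  — where `r ≠ 0` and `|s| < χ₁.rIn` (`rFun_ne_zero_of_F₁_eq_zero`) — the straightening chart
  of the *smooth* function `Ft σ = s + κ χ₁(s) χ₂(r) σ r` (`σ = sign r`, equal to `F₁` where
  `σ r ≥ 0`, globally `C^∞`, and regular there: its derivative along the flow of `U.ξ` is `1`,
  `not_isMCriticalPt_Ft`), transferred to the sector on `{σ r > 0}`
  (`HalfSliceChart.restrCongr`), are half-slice charts avoiding `F`;
* **`BevelData.cornerSliceAtlas : CornerSliceAtlas D.sector B.surface u v π`** and the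
  conclusions `BevelData.sector_smooth_clause` (the smooth items of clause (ii) of
  `IsGKTrisection` for `X₁`: `IsManifold (𝓡∂ 4)`, embedding, immersion off `F`, `IsCornerAt`
  on `F`, `F ⊆ ∂X₁`) and `BevelData.compactSpace_sector`;
* `BevelData.isBoundaryPoint_iff_F₁_eq_zero` — the boundary points of the straightened sector
  are exactly the points of `{F₁ = 0}` (so a set meeting `X₁` inside `{F₁ = 0}` meets it in the
  image of `∂X₁`, `mem_image_boundary_of_F₁_eq_zero`); `frontier_sector_subset`;
* `BevelData.connectedSpace_sector` — `X₁` is connected as soon as the sublevel set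
  `{f ≤ cLow}` (`a - δ_U < cLow < a`) is: every point of `X₁` flows down along `-U.ξ` into it
  without leaving `X₁` (`fl_neg_mem_sector`; this uses that the bump `χ₁` is antitone in `|s|`,
  which is why the explicit bumps `Literature.Topology.FourManifolds.Bump` — built from
  Mathlib's monotone `Real.smoothTransition` — are used rather than the abstract `ContDiffBump`).

## References

* D. Gay, R. Kirby, *Trisecting 4-manifolds*, Geom. Topol. 20 (2016) 3097–3132
  (arXiv:1205.1565): Def. 1 and Fig. 1; §4, Lemma 14 and its proof. [GayKirby2016]
* A. Douady, *Variétés à bord anguleux et voisinages tubulaires*, Séminaire H. Cartan 14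
  (1961/62), exp. 1, §1 and §4. [Douady1961]
* J. Milnor, *Morse theory*, Ann. of Math. Studies 51 (1963), Thm. 3.1 (regular sublevel sets
  are smooth manifolds with boundary). [Milnor1963]
-/

open scoped Manifold ContDiff Topology
open Set Function Metric

noncomputable section

universe u

namespace Literature.Topology.FourManifolds

/-- Local notation: `𝔼 n` is the model Euclidean space `EuclideanSpace ℝ (Fin n)`. -/
local notation "𝔼 " n:arg => EuclideanSpace ℝ (Fin n)

/-! ### A half-slice chart transferred to a set with the same trace on an open subset -/

section Transfer

variable {k : ℕ} {H : Type*} [TopologicalSpace H] {I : ModelWithCorners ℝ (𝔼 (k + 1)) H}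
  {M : Type u} [TopologicalSpace M] [ChartedSpace H M] {S S' : Set M}

/-- **Transfer of a half-slice chart**: a half-slice chart for `S'`, restricted to an open set
`U` on which `S` and `S'` have the same trace, is a half-slice chart for `S` (the notion only
depends on the germ of the set along the source). [folklore] -/
def HalfSliceChart.restrCongr (D : HalfSliceChart I S') (U : Set M) (hU : IsOpen U)
    (h : ∀ q ∈ U, q ∈ S ↔ q ∈ S') : HalfSliceChart I S where
  Θ := D.Θ.restrOpen U hU
  contMDiffOn_toFun := D.contMDiffOn_toFun.mono fun _ hq => hq.1
  contMDiffOn_symm := D.contMDiffOn_symm.mono (by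
    rw [OpenPartialHomeomorph.restrOpen_toPartialEquiv, PartialEquiv.restr_target]
    exact inter_subset_left)
  mem_iff q hq := (h q hq.2).trans (D.mem_iff q hq.1)

/-- The source of the transferred chart is `source ∩ U`. [folklore] -/
theorem HalfSliceChart.restrCongr_source (D : HalfSliceChart I S') (U : Set M) (hU : IsOpen U)
    (h : ∀ q ∈ U, q ∈ S ↔ q ∈ S') : (D.restrCongr U hU h).Θ.source = D.Θ.source ∩ U := rfl

end Transfer

/-! ### Explicit smooth bumps on `ℝ`, monotone in `|x|` -/

/-- An explicit **smooth bump on `ℝ`**: a `C^∞` function with values in `[0, 1]`, equal to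
`1` on `[-rIn, rIn]`, to `0` off `(-rOut, rOut)`, and *antitone in `|x|`* (this last property —
needed when the bevel is followed along flow lines — is why Mathlib's abstract `ContDiffBump`,
whose profile is an unspecified choice, is not used). [folklore] -/
structure Bump where
  /-- The function. -/
  toFun : ℝ → ℝ
  /-- Inner radius. -/
  rIn : ℝ
  /-- Outer radius. -/
  rOut : ℝ
  /-- The inner radius is positive. -/
  rIn_pos : 0 < rIn
  /-- The radii are ordered. -/
  rIn_lt_rOut : rIn < rOut
  /-- Smoothness. -/
  contDiff : ContDiff ℝ ∞ toFun
  /-- Nonnegativity. -/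
  nonneg' : ∀ x, 0 ≤ toFun x
  /-- Bounded by one. -/
  le_one' : ∀ x, toFun x ≤ 1
  /-- Equal to `1` on `[-rIn, rIn]`. -/
  eq_one' : ∀ x, |x| ≤ rIn → toFun x = 1
  /-- Equal to `0` off `(-rOut, rOut)`. -/
  eq_zero' : ∀ x, rOut ≤ |x| → toFun x = 0
  /-- Antitone in `|x|`. -/
  antitone' : ∀ x y, |x| ≤ |y| → toFun y ≤ toFun x

namespace Bump

/-- A bump is used as a function `ℝ → ℝ`. [folklore] -/
instance : CoeFun Bump fun _ => ℝ → ℝ := ⟨Bump.toFun⟩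

variable (χ : Bump)

/-- `0 ≤ χ`. [folklore] -/
theorem nonneg {x : ℝ} : 0 ≤ χ x := χ.nonneg' x

/-- `χ ≤ 1`. [folklore] -/
theorem le_one {x : ℝ} : χ x ≤ 1 := χ.le_one' x

/-- `χ = 1` on `[-rIn, rIn]`. [folklore] -/
theorem one_of_abs_le {x : ℝ} (h : |x| ≤ χ.rIn) : χ x = 1 := χ.eq_one' x h

/-- `χ = 0` off `(-rOut, rOut)`. [folklore] -/
theorem zero_of_le_abs {x : ℝ} (h : χ.rOut ≤ |x|) : χ x = 0 := χ.eq_zero' x h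

/-- `χ` is antitone in `|x|`. [folklore] -/
theorem antitone_abs {x y : ℝ} (h : |x| ≤ |y|) : χ y ≤ χ x := χ.antitone' x y h

/-- `χ` is continuous. [folklore] -/
protected theorem continuous : Continuous χ := χ.contDiff.continuous

/-- `rOut > 0`. [folklore] -/
theorem rOut_pos : 0 < χ.rOut := χ.rIn_pos.trans χ.rIn_lt_rOut

/-- Near a point of `(-rIn, rIn)`, `χ` is eventually `1`. [folklore] -/
theorem eventuallyEq_one {x : ℝ} (h : |x| < χ.rIn) : (χ : ℝ → ℝ) =ᶠ[𝓝 x] fun _ => 1 := by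
  have hopen : IsOpen {y : ℝ | |y| < χ.rIn} := isOpen_lt continuous_abs continuous_const
  filter_upwards [hopen.mem_nhds h] with y hy
  exact χ.one_of_abs_le (le_of_lt hy)

/-- **The standard bump with radii `r < R`**: `x ↦ smoothTransition ((R² - x²)/(R² - r²))`
(Mathlib's `Real.smoothTransition`, smooth and monotone). [folklore] -/
def ofRadii (r R : ℝ) (hr : 0 < r) (hrR : r < R) : Bump where
  toFun x := Real.smoothTransition ((R ^ 2 - x ^ 2) / (R ^ 2 - r ^ 2))
  rIn := r
  rOut := R
  rIn_pos := hr
  rIn_lt_rOut := hrR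
  contDiff := Real.smoothTransition.contDiff.comp
    ((contDiff_const.sub (contDiff_id.pow 2)).div_const _)
  nonneg' _ := Real.smoothTransition.nonneg _
  le_one' _ := Real.smoothTransition.le_one _
  eq_one' x hx := by
    have hRr : 0 < R ^ 2 - r ^ 2 := by nlinarith
    apply Real.smoothTransition.one_of_one_le
    rw [le_div_iff₀ hRr, one_mul]
    have : x ^ 2 ≤ r ^ 2 := by nlinarith [abs_nonneg x, sq_abs x]
    linarith
  eq_zero' x hx := by
    have hRr : 0 < R ^ 2 - r ^ 2 := by nlinarith
    apply Real.smoothTransition.zero_of_nonpos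
    rw [div_nonpos_iff]
    refine Or.inr ⟨?_, hRr.le⟩
    have : R ^ 2 ≤ x ^ 2 := by
      have hR : 0 ≤ R := (hr.trans hrR).le
      nlinarith [abs_nonneg x, sq_abs x]
    linarith
  antitone' x y hxy := by
    have hRr : 0 < R ^ 2 - r ^ 2 := by nlinarith
    apply Real.smoothTransition.monotone
    apply div_le_div_of_nonneg_right _ hRr.le
    have : x ^ 2 ≤ y ^ 2 := by nlinarith [abs_nonneg x, sq_abs x, sq_abs y]
    linarith

end Bump

variable {X : Type u} [TopologicalSpace X] [T2Space X] [CompactSpace X]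
  [ChartedSpace (𝔼 4) X] [IsManifold (𝓡 4) ∞ X]

namespace BiCollar

variable (B : BiCollar X)

/-! ### The surface `F` as a subset of `X` -/

/-- The surface `F = {f = a, g = b}` as a subset of `X` (the corner locus of the sectors).
[cite: GayKirby2016, §4, Lemma 14] -/
def surface : Set X := range fun z : B.F => RegularLevel.incl B.hf (RegularLevel.incl B.hg z)

omit [T2Space X] [CompactSpace X] in
/-- Points of the surface, parametrised. [folklore] -/
theorem mem_surface (z : B.F) : RegularLevel.incl B.hf (RegularLevel.incl B.hg z) ∈ B.surface := ⟨z, rfl⟩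

/-- **The surface is `{s = 0, r = 0}`.** [cite: GayKirby2016, §4, Lemma 14] -/
theorem mem_surface_iff (x : X) : x ∈ B.surface ↔ B.sFun x = 0 ∧ B.rFun x = 0 := by
  constructor
  · rintro ⟨z, rfl⟩
    exact ⟨B.sFun_incl _, B.rFun_incl_incl z⟩
  · rintro ⟨hs, hr⟩
    have hfx : B.f x = B.a := by have := B.f_eq_add_sFun x; rw [hs, add_zero] at this; exact this
    set y : B.Y := ⟨x, hfx⟩ with hy
    have hyL : B.yL x = y := B.yL_incl y
    have hgy : B.g y = B.b := by
      have : B.rFun x = B.g (B.yL x) - B.b := rfl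
      rw [hyL] at this; linarith
    exact ⟨⟨y, hgy⟩, rfl⟩

/-- `π` takes values in the surface. [cite: Douady1961, §1 and §4] -/
theorem π_mem_surface (x : X) : B.π x ∈ B.surface := B.mem_surface _

/-- `yL` is constant along the flow of `U` inside the band. [cite: MilnorHCobordism1965, proof of Thm. 3.4] -/
theorem yL_fl_eq {x : X} (hx : x ∈ B.U.band) {t : ℝ} (ht : B.f x + t ∈ Ioo (B.a - B.U.δ) (B.a + B.U.δ)) :
    B.yL (B.U.fl x t) = B.yL x := by
  apply (RegularLevel.isEmbedding_incl B.hf).injective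
  have hxt : B.U.fl x t ∈ B.U.band := by
    rw [LevelUnitField.mem_band_iff, B.U.apply_fl_eq_add hx ht]; exact ht
  rw [B.incl_yL hxt, B.incl_yL hx]
  exact B.U.drop_fl hx ht

/-- `r` is constant along the flow of `U` inside the band. [cite: MilnorHCobordism1965, proof of Thm. 3.4] -/
theorem rFun_fl_eq {x : X} (hx : x ∈ B.U.band) {t : ℝ} (ht : B.f x + t ∈ Ioo (B.a - B.U.δ) (B.a + B.U.δ)) :
    B.rFun (B.U.fl x t) = B.rFun x := by
  rw [rFun, B.yL_fl_eq hx ht]; rfl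

/-- `s (fl x t) = s x + t` inside the band. [cite: MilnorHCobordism1965, proof of Thm. 3.4] -/
theorem sFun_fl_eq {x : X} (hx : x ∈ B.U.band) {t : ℝ} (ht : B.f x + t ∈ Ioo (B.a - B.U.δ) (B.a + B.U.δ)) :
    B.sFun (B.U.fl x t) = B.sFun x + t := by
  rw [sFun, sFun, B.U.apply_fl_eq_add hx ht]; ring

omit [T2Space X] [CompactSpace X] in
/-- `|s x| < δ_U` iff `x` lies in the band of `U`. [folklore] -/
theorem abs_sFun_lt_iff (x : X) : |B.sFun x| < B.U.δ ↔ x ∈ B.U.band := by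
  rw [LevelUnitField.mem_band_iff, B.f_eq_add_sFun, abs_lt]
  constructor
  · rintro ⟨h1, h2⟩; exact ⟨by linarith, by linarith⟩
  · rintro ⟨h1, h2⟩; exact ⟨by linarith, by linarith⟩

/-! ### Signs; the open sets `{σ r > 0}` -/

/-- The sign used at a boundary point of a bevelled sector: `1` if `r > 0`, `-1` otherwise. [folklore] -/
def bevelSign (r : ℝ) : ℝ := if 0 < r then 1 else -1

omit [T2Space X] [CompactSpace X] in
/-- `bevelSign r = ±1`. [folklore] -/
theorem bevelSign_eq_or (r : ℝ) : bevelSign r = 1 ∨ bevelSign r = -1 := by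
  unfold bevelSign; split_ifs <;> simp

omit [T2Space X] [CompactSpace X] in
/-- `bevelSign r · r > 0` for `r ≠ 0`. [folklore] -/
theorem bevelSign_mul_pos {r : ℝ} (hr : r ≠ 0) : 0 < bevelSign r * r := by
  unfold bevelSign
  split_ifs with h
  · rw [one_mul]; exact h
  · have : r < 0 := lt_of_le_of_ne (not_lt.1 h) hr
    nlinarith

omit [T2Space X] [CompactSpace X] in
/-- If `σ = ±1` and `σ r > 0` then `σ r = |r|`. [folklore] -/
theorem sign_mul_eq_abs {σ r : ℝ} (hσ : σ = 1 ∨ σ = -1) (h : 0 < σ * r) : σ * r = |r| := by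
  rcases hσ with rfl | rfl
  · rw [one_mul] at h ⊢; exact (abs_of_pos h).symm
  · have hr : r < 0 := by nlinarith
    rw [abs_of_neg hr]; ring

/-- The open set `{σ r > 0}` inside the band of `U`. [folklore] -/
def posSet (σ : ℝ) : Set X := B.U.band ∩ B.rFun ⁻¹' {r | 0 < σ * r}

/-- `posSet σ` is open. [folklore] -/
theorem isOpen_posSet (σ : ℝ) : IsOpen (B.posSet σ) :=
  B.continuousOn_rFun.isOpen_inter_preimage B.U.isOpen_band
    (isOpen_lt continuous_const (continuous_const.mul continuous_id))

/-- `posSet σ` avoids the surface (`r ≠ 0` there). [folklore] -/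
theorem not_mem_surface_of_mem_posSet {σ : ℝ} {q : X} (hq : q ∈ B.posSet σ) : q ∉ B.surface := by
  intro h
  have hr : B.rFun q = 0 := ((B.mem_surface_iff q).1 h).2
  have h0 : 0 < σ * B.rFun q := hq.2
  rw [hr, mul_zero] at h0
  exact lt_irrefl _ h0

/-- The surface lies in every box of positive radius. [folklore] -/
theorem mem_box_of_mem_surface {ε : ℝ} (hε : 0 < ε) {x : X} (hx : x ∈ B.surface) : x ∈ B.box ε := by
  obtain ⟨hs, hr⟩ := (B.mem_surface_iff x).1 hx
  rw [mem_box_iff, hs, hr, abs_zero]; exact ⟨hε, hε⟩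

/-! ### Bevel data -/

/-- **Bevel data** for a bi-collar: two smooth bumps `χ₁` (in `s`) and `χ₂` (in `r`) centred
at `0` and a slope `κ > 0`, with `χ₁.rOut < δ_U`, `χ₂.rOut < δ_V` (the bevel lives inside the
bands), `κ ≤ 1` and `κ · χ₂.rOut < χ₁.rIn` (so that on the bevelled boundary, where
`|s| ≤ κ χ₂.rOut`, the bump `χ₁` is identically `1`). [cite: GayKirby2016, Def. 1 and Fig. 1] -/
structure BevelData where
  /-- The bump in the coordinate `s`. -/
  χ₁ : Bump
  /-- The bump in the coordinate `r`. -/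
  χ₂ : Bump
  /-- The slope of the bevel. -/
  κ : ℝ
  /-- The slope is positive. -/
  κ_pos : 0 < κ
  /-- The slope is at most `1`. -/
  κ_le_one : κ ≤ 1
  /-- The `s`-bump is supported in the band of `U`. -/
  rOut₁_lt : χ₁.rOut < B.U.δ
  /-- The `r`-bump is supported in the band of `V`. -/
  rOut₂_lt : χ₂.rOut < B.V.δ
  /-- The bevel is shallow: `κ χ₂.rOut < χ₁.rIn`. -/
  κ_mul_rOut₂_lt : κ * χ₂.rOut < χ₁.rIn

omit [T2Space X] [CompactSpace X] in
/-- **Bevel data exist** (`χ₁` with radii `δ_U/4 < δ_U/2`, `χ₂` with radii `δ_V/4 < δ_V/2`,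
`κ = min 1 (δ_U / (4 δ_V))`). [folklore] -/
theorem nonempty_bevelData : Nonempty B.BevelData := by
  have hU := B.U.δ_pos
  have hV := B.V.δ_pos
  refine ⟨{ χ₁ := Bump.ofRadii (B.U.δ / 4) (B.U.δ / 2) (by linarith) (by linarith)
            χ₂ := Bump.ofRadii (B.V.δ / 4) (B.V.δ / 2) (by linarith) (by linarith)
            κ := min 1 (B.U.δ / (4 * B.V.δ))
            κ_pos := lt_min one_pos (by positivity)
            κ_le_one := min_le_left _ _
            rOut₁_lt := by show B.U.δ / 2 < B.U.δ; linarith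
            rOut₂_lt := by show B.V.δ / 2 < B.V.δ; linarith
            κ_mul_rOut₂_lt := ?_ }⟩
  show min 1 (B.U.δ / (4 * B.V.δ)) * (B.V.δ / 2) < B.U.δ / 4
  have h1 : min 1 (B.U.δ / (4 * B.V.δ)) * (B.V.δ / 2) ≤ B.U.δ / (4 * B.V.δ) * (B.V.δ / 2) :=
    mul_le_mul_of_nonneg_right (min_le_right _ _) (by linarith)
  have h2 : B.U.δ / (4 * B.V.δ) * (B.V.δ / 2) = B.U.δ / 8 := by field_simp; ring
  linarith

namespace BevelData

variable {B} (D : B.BevelData)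

omit [T2Space X] [CompactSpace X] in
/-- `χ₁.rIn < δ_U`. [folklore] -/
theorem rIn₁_lt : D.χ₁.rIn < B.U.δ := D.χ₁.rIn_lt_rOut.trans D.rOut₁_lt

omit [T2Space X] [CompactSpace X] in
/-- `χ₂.rIn < δ_V`. [folklore] -/
theorem rIn₂_lt : D.χ₂.rIn < B.V.δ := D.χ₂.rIn_lt_rOut.trans D.rOut₂_lt

/-! ### The bevel function `θ` and the defining function `F₁ = s + κ θ` -/

/-- The **bevel function** `θ = χ₁(s) · χ₂(r) · |r|`: equal to `|r|` near `F`, zero away from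
the bi-collar box, continuous, smooth off `{r = 0}`. [cite: GayKirby2016, Def. 1 and Fig. 1] -/
def θ (x : X) : ℝ := D.χ₁ (B.sFun x) * (D.χ₂ (B.rFun x) * |B.rFun x|)

/-- The **defining function** `F₁ = s + κ θ` of the bevelled sector. [cite: GayKirby2016, Def. 1 and Fig. 1] -/
def F₁ (x : X) : ℝ := B.sFun x + D.κ * D.θ x

/-- **The bevelled sector** `X₁ = {F₁ ≤ 0} = {f ≤ a - κ θ}`. [cite: GayKirby2016, §4, Lemma 14] -/
def sector : Set X := D.F₁ ⁻¹' Iic 0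

/-- The radius `εw = min χ₁.rIn χ₂.rIn` of the box on which the sector is an exact wedge. [folklore] -/
def εw : ℝ := min D.χ₁.rIn D.χ₂.rIn

omit [T2Space X] [CompactSpace X] in
/-- `εw > 0`. [folklore] -/
theorem εw_pos : 0 < D.εw := lt_min D.χ₁.rIn_pos D.χ₂.rIn_pos

omit [T2Space X] [CompactSpace X] in
/-- `εw ≤ δ_U`. [folklore] -/
theorem εw_le_δU : D.εw ≤ B.U.δ := (min_le_left _ _).trans D.rIn₁_lt.le

omit [T2Space X] [CompactSpace X] in
/-- `εw ≤ δ_V`. [folklore] -/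
theorem εw_le_δV : D.εw ≤ B.V.δ := (min_le_right _ _).trans D.rIn₂_lt.le

/-- **The wedge frame of `X₁`**: `u = -s - κ r`, `v = -s + κ r` (determinant `-2κ ≠ 0`); the
sector `{s ≤ -κ|r|}` is `{u ≥ 0, v ≥ 0}`. [cite: GayKirby2016, Def. 1 and Fig. 1] -/
def frame : WedgeFrame where
  α := -1
  β := -D.κ
  γ := -1
  δ := D.κ
  det_ne_zero := by have := D.κ_pos; nlinarith

variable {D}

/-- Membership in the sector (definitional). [folklore] -/
theorem mem_sector_iff {x : X} : x ∈ D.sector ↔ D.F₁ x ≤ 0 := Iff.rfl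

variable (D)

omit [T2Space X] [CompactSpace X] in
/-- `χ₂(r) |r| ≤ χ₂.rOut`. [folklore] -/
theorem χ₂_mul_abs_le (r : ℝ) : D.χ₂ r * |r| ≤ D.χ₂.rOut := by
  rcases lt_or_ge |r| D.χ₂.rOut with h | h
  · calc D.χ₂ r * |r| ≤ 1 * |r| := mul_le_mul_of_nonneg_right D.χ₂.le_one (abs_nonneg r)
      _ ≤ D.χ₂.rOut := by rw [one_mul]; exact h.le
  · rw [D.χ₂.zero_of_le_abs h, zero_mul]
    exact D.χ₂.rOut_pos.le

omit [T2Space X] [CompactSpace X] in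
/-- `0 ≤ χ₂(r) |r|`. [folklore] -/
theorem χ₂_mul_abs_nonneg (r : ℝ) : 0 ≤ D.χ₂ r * |r| := mul_nonneg D.χ₂.nonneg (abs_nonneg r)

/-- `0 ≤ θ`. [folklore] -/
theorem θ_nonneg (x : X) : 0 ≤ D.θ x := mul_nonneg D.χ₁.nonneg (D.χ₂_mul_abs_nonneg _)

/-- `θ ≤ χ₂.rOut`. [folklore] -/
theorem θ_le (x : X) : D.θ x ≤ D.χ₂.rOut :=
  calc D.θ x ≤ 1 * (D.χ₂ (B.rFun x) * |B.rFun x|) :=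
        mul_le_mul_of_nonneg_right D.χ₁.le_one (D.χ₂_mul_abs_nonneg _)
    _ ≤ D.χ₂.rOut := by rw [one_mul]; exact D.χ₂_mul_abs_le _

/-- `θ = 0` where `|s| ≥ χ₁.rOut`. [folklore] -/
theorem θ_eq_zero_of_le {x : X} (h : D.χ₁.rOut ≤ |B.sFun x|) : D.θ x = 0 := by
  rw [θ, D.χ₁.zero_of_le_abs h, zero_mul]

/-- `θ = 0` where `r = 0`. [folklore] -/
theorem θ_eq_zero_of_rFun_eq_zero {x : X} (h : B.rFun x = 0) : D.θ x = 0 := by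
  rw [θ, h, abs_zero, mul_zero, mul_zero]

/-- **On the box of radius `εw`, `θ = |r|`.** [cite: GayKirby2016, Def. 1 and Fig. 1] -/
theorem θ_eq_abs_of_mem_box {x : X} (hx : x ∈ B.box D.εw) : D.θ x = |B.rFun x| := by
  have h1 : D.χ₁ (B.sFun x) = 1 := D.χ₁.one_of_abs_le (hx.1.trans_le (min_le_left _ _)).le
  have h2 : D.χ₂ (B.rFun x) = 1 := D.χ₂.one_of_abs_le (hx.2.trans_le (min_le_right _ _)).le
  rw [θ, h1, h2, one_mul, one_mul]

/-- `s ≤ 0` on the sector (`s = F₁ - κ θ ≤ -κ θ ≤ 0`). [cite: GayKirby2016, §4, Lemma 14] -/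
theorem sFun_nonpos_of_mem_sector {x : X} (hx : x ∈ D.sector) : B.sFun x ≤ 0 := by
  have h : B.sFun x + D.κ * D.θ x ≤ 0 := hx
  nlinarith [D.θ_nonneg x, D.κ_pos]

/-- `|s| = κ θ` hence `|s| ≤ κ χ₂.rOut < χ₁.rIn` on the level `{F₁ = 0}`. [folklore] -/
theorem abs_sFun_lt_rIn_of_F₁_eq_zero {x : X} (h0 : D.F₁ x = 0) : |B.sFun x| < D.χ₁.rIn := by
  have h : B.sFun x = -(D.κ * D.θ x) := by have h' : B.sFun x + D.κ * D.θ x = 0 := h0; linarith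
  rw [h, abs_neg, abs_of_nonneg (mul_nonneg D.κ_pos.le (D.θ_nonneg x))]
  calc D.κ * D.θ x ≤ D.κ * D.χ₂.rOut := mul_le_mul_of_nonneg_left (D.θ_le x) D.κ_pos.le
    _ < D.χ₁.rIn := D.κ_mul_rOut₂_lt

/-- Points of the level `{F₁ = 0}` lie in the band of `U`. [folklore] -/
theorem mem_band_of_F₁_eq_zero {x : X} (h0 : D.F₁ x = 0) : x ∈ B.U.band :=
  B.mem_band_U ((D.abs_sFun_lt_rIn_of_F₁_eq_zero h0).trans D.rIn₁_lt)

/-- **`{f ≤ a - κ χ₂.rOut} ⊆ X₁ ⊆ {f ≤ a}`**, lower inclusion. [cite: GayKirby2016, §4, Lemma 14] -/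
theorem mem_sector_of_sFun_le {x : X} (hx : B.sFun x ≤ -(D.κ * D.χ₂.rOut)) : x ∈ D.sector := by
  show B.sFun x + D.κ * D.θ x ≤ 0
  nlinarith [D.θ_le x, D.κ_pos]

/-! #### Continuity of `θ` and `F₁`; the sector is closed -/

/-- `θ` is continuous on the band of `U`. [folklore] -/
theorem continuousOn_θ_band : ContinuousOn D.θ B.U.band :=
  (D.χ₁.continuous.comp_continuousOn B.contMDiff_sFun.continuous.continuousOn).mul
    ((D.χ₂.continuous.comp_continuousOn B.continuousOn_rFun).mul
      (continuous_abs.comp_continuousOn B.continuousOn_rFun))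

/-- **`θ` is continuous** (continuous on the band, and locally zero off `{|s| ≤ χ₁.rOut}`,
which lies inside the band). [folklore] -/
theorem continuous_θ : Continuous D.θ := by
  rw [continuous_iff_continuousAt]
  intro x
  by_cases hx : x ∈ B.U.band
  · exact D.continuousOn_θ_band.continuousAt (B.U.isOpen_band.mem_nhds hx)
  · -- off the band `|s| ≥ δ_U > χ₁.rOut`, so `θ = 0` near `x`
    have hs : B.U.δ ≤ |B.sFun x| := by
      by_contra h; exact hx ((B.abs_sFun_lt_iff x).1 (not_le.1 h))
    have hopen : IsOpen {y : X | D.χ₁.rOut < |B.sFun y|} :=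
      isOpen_lt continuous_const (continuous_abs.comp B.contMDiff_sFun.continuous)
    have hmem : x ∈ {y : X | D.χ₁.rOut < |B.sFun y|} := D.rOut₁_lt.trans_le hs
    have hev : D.θ =ᶠ[𝓝 x] fun _ => 0 := by
      filter_upwards [hopen.mem_nhds hmem] with y hy
      exact D.θ_eq_zero_of_le (le_of_lt hy)
    exact (continuousAt_const.congr (Filter.EventuallyEq.symm hev))

/-- `F₁` is continuous. [folklore] -/
theorem continuous_F₁ : Continuous D.F₁ :=
  B.contMDiff_sFun.continuous.add (continuous_const.mul D.continuous_θ)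

/-- **The bevelled sector is closed.** [cite: GayKirby2016, §4, Lemma 14] -/
theorem isClosed_sector : IsClosed D.sector := isClosed_Iic.preimage D.continuous_F₁

/-- The bevelled sector is compact. [cite: GayKirby2016, §4, Lemma 14] -/
theorem isCompact_sector : IsCompact D.sector := D.isClosed_sector.isCompact

/-- The bevelled sector is a compact space. [cite: GayKirby2016, §4, Lemma 14] -/
theorem compactSpace_sector : CompactSpace D.sector := isCompact_iff_compactSpace.1 D.isCompact_sector

/-! #### The sector near `F`: an exact wedge; the surface lies on its boundary level -/

/-- **On the box of radius `εw` the sector is the wedge `{u ≥ 0, v ≥ 0}`** of the frame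
`(-1, -κ; -1, κ)`: `s + κ|r| ≤ 0 ↔ (-s - κ r ≥ 0 ∧ -s + κ r ≥ 0)`. [cite: GayKirby2016, Def. 1 and Fig. 1] -/
theorem mem_sector_iff_of_mem_box {x : X} (hx : x ∈ B.box D.εw) :
    x ∈ D.sector ↔ 0 ≤ B.uFun D.frame x ∧ 0 ≤ B.vFun D.frame x := by
  rw [mem_sector_iff, F₁, D.θ_eq_abs_of_mem_box hx]
  show B.sFun x + D.κ * |B.rFun x| ≤ 0 ↔
    0 ≤ -1 * B.sFun x + -D.κ * B.rFun x ∧ 0 ≤ -1 * B.sFun x + D.κ * B.rFun x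
  have hκ := D.κ_pos
  rcases le_total 0 (B.rFun x) with hr | hr
  · rw [abs_of_nonneg hr]
    constructor
    · intro h; constructor <;> nlinarith
    · rintro ⟨h1, h2⟩; nlinarith
  · rw [abs_of_nonpos hr]
    constructor
    · intro h; constructor <;> nlinarith
    · rintro ⟨h1, h2⟩; nlinarith

/-- `F₁ = 0` on the surface. [cite: GayKirby2016, §4, Lemma 14] -/
theorem F₁_eq_zero_of_mem_surface {x : X} (hx : x ∈ B.surface) : D.F₁ x = 0 := by
  obtain ⟨hs, hr⟩ := (B.mem_surface_iff x).1 hx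
  rw [F₁, hs, D.θ_eq_zero_of_rFun_eq_zero hr, mul_zero, add_zero]

/-- The surface lies in the sector. [cite: GayKirby2016, §4, Lemma 14] -/
theorem surface_subset_sector : B.surface ⊆ D.sector := fun _ hx =>
  le_of_eq (D.F₁_eq_zero_of_mem_surface hx)

/-- **Boundary points of the sector off the surface have `r ≠ 0`** (if `r = 0` then `θ = 0`,
so `s = F₁ = 0`, and `{s = r = 0}` is the surface). [cite: GayKirby2016, §4, Lemma 14] -/
theorem rFun_ne_zero_of_F₁_eq_zero {x : X} (h0 : D.F₁ x = 0) (hx : x ∉ B.surface) : B.rFun x ≠ 0 := by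
  intro hr
  apply hx
  rw [B.mem_surface_iff]
  refine ⟨?_, hr⟩
  have : B.sFun x + D.κ * D.θ x = 0 := h0
  rw [D.θ_eq_zero_of_rFun_eq_zero hr, mul_zero, add_zero] at this
  exact this

/-! ### The smooth defining functions `Ft σ = s + κ χ₁(s) χ₂(r) σ r` near boundary points off `F` -/

/-- The **smooth defining function** `Ft σ = s + κ χ₁(s) χ₂(r) (σ r)`: for `σ = sign r` it
agrees with `F₁` where `σ r ≥ 0`, and it is `C^∞` on all of `X`. [cite: Milnor1963, Thm. 3.1] -/
def Ft (σ : ℝ) (x : X) : ℝ := B.sFun x + D.κ * (D.χ₁ (B.sFun x) * (D.χ₂ (B.rFun x) * (σ * B.rFun x)))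

/-- `Ft σ = F₁` where `σ r = |r|`. [folklore] -/
theorem Ft_eq_F₁ {σ : ℝ} {x : X} (h : σ * B.rFun x = |B.rFun x|) : D.Ft σ x = D.F₁ x := by
  rw [Ft, F₁, θ, h]

/-- `Ft σ` is smooth on the band of `U`. [folklore] -/
theorem contMDiffOn_Ft_band (σ : ℝ) : ContMDiffOn (𝓡 4) 𝓘(ℝ, ℝ) ∞ (D.Ft σ) B.U.band := by
  have hs : ContMDiffOn (𝓡 4) 𝓘(ℝ, ℝ) ∞ B.sFun B.U.band := B.contMDiff_sFun.contMDiffOn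
  have h1 : ContMDiffOn (𝓡 4) 𝓘(ℝ, ℝ) ∞ (fun x => D.χ₁ (B.sFun x)) B.U.band :=
    D.χ₁.contDiff.contMDiff.comp_contMDiffOn hs
  have h2 : ContMDiffOn (𝓡 4) 𝓘(ℝ, ℝ) ∞ (fun x => D.χ₂ (B.rFun x)) B.U.band :=
    D.χ₂.contDiff.contMDiff.comp_contMDiffOn B.contMDiffOn_rFun
  exact hs.add (contMDiffOn_const.mul (h1.mul (h2.mul (contMDiffOn_const.mul B.contMDiffOn_rFun))))

/-- Off `{|s| ≤ χ₁.rOut}`, `Ft σ = s`. [folklore] -/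
theorem Ft_eq_sFun_of_lt {σ : ℝ} {x : X} (h : D.χ₁.rOut < |B.sFun x|) : D.Ft σ x = B.sFun x := by
  rw [Ft, D.χ₁.zero_of_le_abs h.le, zero_mul, mul_zero, add_zero]

/-- **`Ft σ` is smooth on all of `X`** (smooth on the band; equal to the smooth function `s` on
the open set `{|s| > χ₁.rOut}`; the two open sets cover `X`). [cite: Milnor1963, Thm. 3.1] -/
theorem contMDiff_Ft (σ : ℝ) : ContMDiff (𝓡 4) 𝓘(ℝ, ℝ) ∞ (D.Ft σ) := by
  intro x
  by_cases hx : x ∈ B.U.band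
  · exact (D.contMDiffOn_Ft_band σ).contMDiffAt (B.U.isOpen_band.mem_nhds hx)
  · have hs : B.U.δ ≤ |B.sFun x| := by
      by_contra h; exact hx ((B.abs_sFun_lt_iff x).1 (not_le.1 h))
    have hopen : IsOpen {y : X | D.χ₁.rOut < |B.sFun y|} :=
      isOpen_lt continuous_const (continuous_abs.comp B.contMDiff_sFun.continuous)
    have hmem : x ∈ {y : X | D.χ₁.rOut < |B.sFun y|} := D.rOut₁_lt.trans_le hs
    have hev : D.Ft σ =ᶠ[𝓝 x] B.sFun := by
      filter_upwards [hopen.mem_nhds hmem] with y hy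
      exact D.Ft_eq_sFun_of_lt hy
    exact B.contMDiff_sFun.contMDiffAt.congr_of_eventuallyEq hev

/-- **`Ft σ` along the flow of `U`**: for `x` in the band and `t` with `f x + t` in the band,
`Ft σ (fl x t) = (s x + t) + κ χ₁(s x + t) χ₂(r x) σ (r x)` (`s` advances at unit speed, `r`
is constant along the flow). [cite: MilnorHCobordism1965, proof of Thm. 3.4] -/
theorem Ft_fl {σ : ℝ} {x : X} (hx : x ∈ B.U.band) {t : ℝ}
    (ht : B.f x + t ∈ Ioo (B.a - B.U.δ) (B.a + B.U.δ)) :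
    D.Ft σ (B.U.fl x t) =
      (B.sFun x + t) + D.κ * (D.χ₁ (B.sFun x + t) * (D.χ₂ (B.rFun x) * (σ * B.rFun x))) := by
  rw [Ft, B.sFun_fl_eq hx ht, B.rFun_fl_eq hx ht]

omit [T2Space X] [CompactSpace X] in
/-- Near a point with `|s| < χ₁.rIn`, the bump `χ₁` has derivative `0`. [folklore] -/
theorem hasDerivAt_χ₁_zero {c : ℝ} (hc : |c| < D.χ₁.rIn) : HasDerivAt D.χ₁ 0 c :=
  (hasDerivAt_const c (1 : ℝ)).congr_of_eventuallyEq (D.χ₁.eventuallyEq_one hc)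

/-- **The derivative of `Ft σ` along the flow of `U` is `1` at points with `|s| < χ₁.rIn`**
(there `χ₁ ≡ 1` to first order, and `r` is constant along the flow). [cite: Milnor1963, Thm. 3.1] -/
theorem hasDerivAt_Ft_comp_fl {σ : ℝ} {x : X} (hs : |B.sFun x| < D.χ₁.rIn) :
    HasDerivAt (fun t => D.Ft σ (B.U.fl x t)) 1 0 := by
  have hxU : x ∈ B.U.band := B.mem_band_U (hs.trans D.rIn₁_lt)
  have hfx : B.f x ∈ Ioo (B.a - B.U.δ) (B.a + B.U.δ) := hxU
  -- the formula holds for `t` near `0`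
  have hev : (fun t => D.Ft σ (B.U.fl x t)) =ᶠ[𝓝 0]
      fun t => (B.sFun x + t) + D.κ * (D.χ₁ (B.sFun x + t) * (D.χ₂ (B.rFun x) * (σ * B.rFun x))) := by
    have hopen : IsOpen ((fun t : ℝ => B.f x + t) ⁻¹' Ioo (B.a - B.U.δ) (B.a + B.U.δ)) :=
      isOpen_Ioo.preimage (continuous_const.add continuous_id)
    have h0 : (0 : ℝ) ∈ (fun t : ℝ => B.f x + t) ⁻¹' Ioo (B.a - B.U.δ) (B.a + B.U.δ) := by
      show B.f x + 0 ∈ Ioo (B.a - B.U.δ) (B.a + B.U.δ); rw [add_zero]; exact hfx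
    filter_upwards [hopen.mem_nhds h0] with t ht
    exact D.Ft_fl hxU ht
  refine HasDerivAt.congr_of_eventuallyEq ?_ hev
  set c : ℝ := D.χ₂ (B.rFun x) * (σ * B.rFun x) with hc
  have h1 : HasDerivAt (fun t : ℝ => B.sFun x + t) 1 0 := (hasDerivAt_id (0 : ℝ)).const_add _
  have h2 : HasDerivAt (fun t : ℝ => D.χ₁ (B.sFun x + t)) 0 0 := by
    have hχ : HasDerivAt (D.χ₁ : ℝ → ℝ) 0 (B.sFun x + 0) := by
      rw [add_zero]; exact D.hasDerivAt_χ₁_zero hs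
    exact hχ.comp_const_add (B.sFun x) 0
  have h3 : HasDerivAt (fun t : ℝ => D.κ * (D.χ₁ (B.sFun x + t) * c)) (D.κ * (0 * c)) 0 :=
    (h2.mul_const c).const_mul D.κ
  have h4 : HasDerivAt (fun t : ℝ => (B.sFun x + t) + D.κ * (D.χ₁ (B.sFun x + t) * c))
      (1 + D.κ * (0 * c)) 0 := h1.add h3
  have h5 : (1 : ℝ) + D.κ * (0 * c) = 1 := by ring
  rw [h5] at h4
  exact h4

/-- **`Ft σ` is regular at every point with `|s| < χ₁.rIn`**: its derivative in the direction
of the unit-speed field `U.ξ` is `1`. [cite: Milnor1963, Thm. 3.1] -/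
theorem not_isMCriticalPt_Ft (σ : ℝ) {x : X} (hs : |B.sFun x| < D.χ₁.rIn) :
    ¬ IsMCriticalPt (𝓡 4) (D.Ft σ) x := by
  intro hcrit
  have hγ := hasDerivAt_comp_integralCurve (D.contMDiff_Ft σ) (isMIntegralCurve_flow B.U.contMDiff x) 0
  have hγ' : HasDerivAt (fun t => D.Ft σ (B.U.fl x t))
      (mlineDeriv (𝓡 4) (D.Ft σ) (flow B.U.contMDiff x 0) (B.U.ξ (flow B.U.contMDiff x 0))) 0 := hγ
  have h1 := D.hasDerivAt_Ft_comp_fl (σ := σ) hs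
  have heq : mlineDeriv (𝓡 4) (D.Ft σ) (flow B.U.contMDiff x 0) (B.U.ξ (flow B.U.contMDiff x 0)) = 1 :=
    hγ'.unique h1
  have hzero : mlineDeriv (𝓡 4) (D.Ft σ) (flow B.U.contMDiff x 0) (B.U.ξ (flow B.U.contMDiff x 0)) = 0 := by
    rw [flow_zero]
    rw [mlineDeriv_def]
    have hc : mfderiv (𝓡 4) 𝓘(ℝ, ℝ) (D.Ft σ) x = 0 := hcrit
    rw [hc]; rfl
  rw [hzero] at heq
  exact zero_ne_one heq


/-! ### Half-slice charts of the sector off the surface -/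

/-- On `posSet σ` (`σ = ±1`) the sector is `{Ft σ ≤ 0}`. [cite: Milnor1963, Thm. 3.1] -/
theorem mem_sector_iff_of_mem_posSet {σ : ℝ} (hσ : σ = 1 ∨ σ = -1) :
    ∀ q ∈ B.posSet σ, q ∈ D.sector ↔ q ∈ D.Ft σ ⁻¹' Iic (0 : ℝ) := by
  intro q hq
  rw [mem_sector_iff, mem_preimage, mem_Iic, D.Ft_eq_F₁ (sign_mul_eq_abs hσ hq.2)]

/-- **The half-slice chart at a boundary point of the sector off the surface**: the
straightening chart of the smooth regular function `Ft σ`, `σ = bevelSign (r p)`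
(`exists_halfSliceChart_of_not_isMCriticalPt'`), transferred to the sector on `posSet σ`.
[cite: Milnor1963, Thm. 3.1] -/
def boundaryChart (p : X) (h0 : D.F₁ p = 0) : HalfSliceChart (𝓡 4) D.sector :=
  (Classical.choose (exists_halfSliceChart_of_not_isMCriticalPt' (D.contMDiff_Ft (bevelSign (B.rFun p))) 0
      (D.not_isMCriticalPt_Ft (bevelSign (B.rFun p)) (D.abs_sFun_lt_rIn_of_F₁_eq_zero h0)))).restrCongr
    (B.posSet (bevelSign (B.rFun p))) (B.isOpen_posSet _) (D.mem_sector_iff_of_mem_posSet (bevelSign_eq_or _))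

/-- The boundary point lies in the source of its chart. [cite: Milnor1963, Thm. 3.1] -/
theorem mem_boundaryChart_source (p : X) (h0 : D.F₁ p = 0) (hp : p ∉ B.surface) :
    p ∈ (D.boundaryChart p h0).Θ.source := by
  refine ⟨(Classical.choose_spec (exists_halfSliceChart_of_not_isMCriticalPt'
    (D.contMDiff_Ft (bevelSign (B.rFun p))) 0
    (D.not_isMCriticalPt_Ft (bevelSign (B.rFun p)) (D.abs_sFun_lt_rIn_of_F₁_eq_zero h0)))).1, ?_⟩
  exact ⟨D.mem_band_of_F₁_eq_zero h0, bevelSign_mul_pos (D.rFun_ne_zero_of_F₁_eq_zero h0 hp)⟩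

/-- The source of a boundary chart avoids the surface. [folklore] -/
theorem not_mem_surface_of_mem_boundaryChart_source {p : X} {h0 : D.F₁ p = 0}
    {q : X} (hq : q ∈ (D.boundaryChart p h0).Θ.source) : q ∉ B.surface :=
  B.not_mem_surface_of_mem_posSet hq.2

/-- **The half-slice chart at an interior point** `F₁ p < 0`: the translated chart of `X`
restricted to `{F₁ < 0}` (`sublevelChartLT'`). [cite: Milnor1963, Thm. 3.1] -/
def interiorChart (p : X) : HalfSliceChart (𝓡 4) D.sector :=
  sublevelChartLT' 3 D.F₁ 0 D.continuous_F₁ p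

/-- An interior point lies in the source of its chart. [folklore] -/
theorem mem_interiorChart_source {p : X} (h : D.F₁ p < 0) : p ∈ (D.interiorChart p).Θ.source :=
  mem_sublevelChartLT'_source_self h

/-- The source of an interior chart avoids the surface (`F₁ < 0` on it, `F₁ = 0` on the
surface). [folklore] -/
theorem not_mem_surface_of_mem_interiorChart_source {p q : X} (hq : q ∈ (D.interiorChart p).Θ.source) :
    q ∉ B.surface := fun h =>
  absurd (D.F₁_eq_zero_of_mem_surface h) (ne_of_lt (lt_of_mem_sublevelChartLT'_source hq))

/-! ### The corner-slice atlas of the bevelled sector and its straightened smooth structure -/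

open Classical in
/-- **The corner-slice atlas of the bevelled sector `X₁`** with corner locus the surface `F`,
normal coordinates `u = -s - κ r`, `v = -s + κ r` and tangential retraction `π`: corner-slice
charts from the bi-collar at the points of `F` (`BiCollar.cornerSliceChart`, the sector being
the wedge `{u, v ≥ 0}` on the box of radius `εw`), interior charts at points with `F₁ < 0`,
boundary charts at points with `F₁ = 0` off `F`. [cite: GayKirby2016, Def. 1 and Fig. 1] -/
def cornerSliceAtlas : CornerSliceAtlas D.sector B.surface (B.uFun D.frame) (B.vFun D.frame) B.π where
  halfDatum p hp :=
    if h : D.F₁ p.1 < 0 then D.interiorChart p.1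
    else D.boundaryChart p.1 (le_antisymm p.2 (not_lt.1 h))
  half_mem_source p hp := by
    by_cases h : D.F₁ p.1 < 0
    · rw [dif_pos h]; exact D.mem_interiorChart_source h
    · rw [dif_neg h]; exact D.mem_boundaryChart_source _ _ hp
  half_not_mem p hp q hq := by
    by_cases h : D.F₁ p.1 < 0
    · rw [dif_pos h] at hq; exact D.not_mem_surface_of_mem_interiorChart_source hq
    · rw [dif_neg h] at hq; exact D.not_mem_surface_of_mem_boundaryChart_source hq
  cornerDatum p _ :=
    B.cornerSliceChart D.frame (chartAt (𝔼 2) (B.zL p.1)) D.εw (IsManifold.chart_mem_maximalAtlas _)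
      D.εw_pos D.εw_le_δU D.εw_le_δV (fun _ hx => D.mem_sector_iff_of_mem_box hx)
      (fun x _ => B.mem_surface_iff x)
  corner_mem_source p hp :=
    B.mem_cornerSliceChart_source D.frame D.εw_pos D.εw_le_δU D.εw_le_δV _ _
      (B.mem_box_of_mem_surface D.εw_pos hp)

/-- **The bevelled sector `X₁` with its angle along `F` straightened satisfies the smooth
items of clause (ii) of `Literature.Topology.FourManifolds.IsGKTrisection`**: with the charted
space structure of `D.cornerSliceAtlas` it is a `C^∞` manifold with boundary modelled on
`𝓡∂ 4`, its inclusion is a topological embedding with image the sector, a `C^∞` immersion at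
every point off the surface `F` and has a corner chart (`IsCornerAt`) at every point of `F`,
and the points of `F` are boundary points. [cite: GayKirby2016, Def. 1 and Fig. 1] -/
theorem sector_smooth_clause :
    letI := D.cornerSliceAtlas.chartedSpace
    IsManifold (𝓡∂ 4) ∞ D.sector ∧ Topology.IsEmbedding (Subtype.val : D.sector → X) ∧
      range (Subtype.val : D.sector → X) = D.sector ∧
      (∀ w : D.sector, w.1 ∉ B.surface → Manifold.IsImmersionAt (𝓡∂ 4) (𝓡 4) ∞ (Subtype.val : D.sector → X) w) ∧
      (∀ w : D.sector, w.1 ∈ B.surface → IsCornerAt (Subtype.val : D.sector → X) w) ∧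
      (∀ w : D.sector, w.1 ∈ B.surface → w ∈ (𝓡∂ 4).boundary D.sector) :=
  D.cornerSliceAtlas.sector_smooth_clause


/-! ### Boundary points of the straightened sector are the points of the level `{F₁ = 0}` -/

/-- In the boundary chart, the `0`-th coordinate is `-Ft σ` (the straightening chart of
`exists_halfSliceChart_of_not_isMCriticalPt'` has `0`-th coordinate `a - f` with `a = 0`).
[cite: Milnor1963, Thm. 3.1] -/
theorem boundaryChart_apply_zero (p : X) (h0 : D.F₁ p = 0) {q : X}
    (hq : q ∈ (D.boundaryChart p h0).Θ.source) :
    (D.boundaryChart p h0).Θ q 0 = -D.Ft (bevelSign (B.rFun p)) q := by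
  have h := (Classical.choose_spec (exists_halfSliceChart_of_not_isMCriticalPt'
    (D.contMDiff_Ft (bevelSign (B.rFun p))) 0
    (D.not_isMCriticalPt_Ft (bevelSign (B.rFun p)) (D.abs_sFun_lt_rIn_of_F₁_eq_zero h0)))).2 q hq.1
  rw [zero_sub] at h
  exact h

/-- **A point of the straightened sector is a boundary point iff `F₁ = 0` there** (points of
`F` are corner points, hence boundary points, and have `F₁ = 0`; off `F` the half-slice
coordinate is `-F₁` at boundary points and positive at interior points).
[cite: GayKirby2016, Def. 1 and Fig. 1] -/
theorem isBoundaryPoint_iff_F₁_eq_zero (p : D.sector) :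
    letI := D.cornerSliceAtlas.chartedSpace
    (𝓡∂ 4).IsBoundaryPoint p ↔ D.F₁ p.1 = 0 := by
  letI := D.cornerSliceAtlas.chartedSpace
  by_cases hp : p.1 ∈ B.surface
  · exact ⟨fun _ => D.F₁_eq_zero_of_mem_surface hp, fun _ => D.cornerSliceAtlas.isBoundaryPoint_of_mem p hp⟩
  · rw [D.cornerSliceAtlas.isBoundaryPoint_iff_of_not_mem p hp]
    by_cases h : D.F₁ p.1 < 0
    · have hdat : D.cornerSliceAtlas.halfDatum p hp = D.interiorChart p.1 := dif_pos h
      rw [hdat]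
      have hpos := sublevelChartLT'_apply_zero_pos (k := 3) (D.mem_interiorChart_source h)
      constructor
      · intro h0; exact absurd h0 (ne_of_gt hpos)
      · intro h0; exact absurd h0 (ne_of_lt h)
    · have h0 : D.F₁ p.1 = 0 := le_antisymm p.2 (not_lt.1 h)
      have hdat : D.cornerSliceAtlas.halfDatum p hp = D.boundaryChart p.1 h0 := dif_neg h
      rw [hdat, D.boundaryChart_apply_zero p.1 h0 (D.mem_boundaryChart_source p.1 h0 hp)]
      have hσ := D.Ft_eq_F₁ (sign_mul_eq_abs (bevelSign_eq_or (B.rFun p.1))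
        (bevelSign_mul_pos (D.rFun_ne_zero_of_F₁_eq_zero h0 hp)))
      rw [hσ, h0, neg_zero]

/-- Points of the sector with `F₁ = 0` are images of boundary points of the straightened
sector (the form in which clause (ii) of `IsGKTrisection` asks that the other sectors meet
this one). [cite: GayKirby2016, Def. 1] -/
theorem mem_image_boundary_of_F₁_eq_zero {x : X} (hx : x ∈ D.sector) (h0 : D.F₁ x = 0) :
    letI := D.cornerSliceAtlas.chartedSpace
    x ∈ (Subtype.val : D.sector → X) '' (𝓡∂ 4).boundary D.sector := by
  letI := D.cornerSliceAtlas.chartedSpace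
  exact ⟨⟨x, hx⟩, (D.isBoundaryPoint_iff_F₁_eq_zero ⟨x, hx⟩).2 h0, rfl⟩

/-- The frontier of the sector in `X` lies in the level `{F₁ = 0}` (`{F₁ < 0}` is open).
[folklore] -/
theorem frontier_sector_subset : frontier D.sector ⊆ {x | D.F₁ x = 0} := by
  intro x hx
  have hcl : x ∈ D.sector := D.isClosed_sector.closure_subset hx.1
  have hle : D.F₁ x ≤ 0 := hcl
  rcases hle.lt_or_eq with hlt | heq
  · exfalso
    apply hx.2
    have hopen : IsOpen {y : X | D.F₁ y < 0} := isOpen_lt D.continuous_F₁ continuous_const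
    have hsub : {y : X | D.F₁ y < 0} ⊆ D.sector := fun y (hy : D.F₁ y < 0) => mem_sector_iff.2 hy.le
    exact interior_maximal hsub hopen hlt
  · exact heq

/-! ### Connectedness: flowing down into the sublevel set `{f ≤ cLow}` -/

/-- The margin `η = (δ_U - κ χ₂.rOut)/2 > 0` used to flow boundary points strictly into the
lower sublevel set while staying in the band. [folklore] -/
def ηLow : ℝ := (B.U.δ - D.κ * D.χ₂.rOut) / 2

omit [T2Space X] [CompactSpace X] in
/-- `η > 0`. [folklore] -/
theorem ηLow_pos : 0 < D.ηLow := by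
  have h1 : D.κ * D.χ₂.rOut < B.U.δ := D.κ_mul_rOut₂_lt.trans D.rIn₁_lt
  unfold ηLow; linarith

/-- The level `cLow = a - κ χ₂.rOut - η` below which the sector is all of `{f ≤ cLow}`.
[folklore] -/
def cLow : ℝ := B.a - D.κ * D.χ₂.rOut - D.ηLow

omit [T2Space X] [CompactSpace X] in
/-- `a - δ_U < cLow`. [folklore] -/
theorem sub_lt_cLow : B.a - B.U.δ < D.cLow := by
  have h1 : D.κ * D.χ₂.rOut < B.U.δ := D.κ_mul_rOut₂_lt.trans D.rIn₁_lt
  unfold cLow ηLow; linarith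

omit [T2Space X] [CompactSpace X] in
/-- `cLow < a`. [folklore] -/
theorem cLow_lt : D.cLow < B.a := by
  have := D.ηLow_pos
  have := mul_pos D.κ_pos D.χ₂.rOut_pos
  unfold cLow; linarith

/-- `{f ≤ cLow} ⊆ X₁`. [cite: GayKirby2016, §4, Lemma 14] -/
theorem preimage_Iic_cLow_subset : B.f ⁻¹' Iic D.cLow ⊆ D.sector := fun x hx => by
  apply D.mem_sector_of_sFun_le
  have h : B.f x ≤ D.cLow := hx
  have := D.ηLow_pos
  rw [B.f_eq_add_sFun] at h
  unfold cLow at h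
  linarith

/-- **The sector is flow-invariant downwards**: for `y ∈ X₁` in the band and `t ≥ 0` with
`f y - t` in the band, `fl y (-t) ∈ X₁`.  Indeed `s` decreases, `r` is constant, and since
`s y ≤ 0` the bump `χ₁` (antitone in `|s|`) does not increase: `F₁` does not increase.
[cite: GayKirby2016, §4, Lemma 14] -/
theorem fl_neg_mem_sector {y : X} (hy : y ∈ D.sector) (hyU : y ∈ B.U.band) {t : ℝ} (ht : 0 ≤ t)
    (hband : B.f y + -t ∈ Ioo (B.a - B.U.δ) (B.a + B.U.δ)) : B.U.fl y (-t) ∈ D.sector := by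
  have hs0 : B.sFun y ≤ 0 := D.sFun_nonpos_of_mem_sector hy
  have hF : B.sFun y + D.κ * D.θ y ≤ 0 := hy
  show B.sFun (B.U.fl y (-t)) + D.κ * D.θ (B.U.fl y (-t)) ≤ 0
  rw [θ, B.sFun_fl_eq hyU hband, B.rFun_fl_eq hyU hband]
  have hχ : D.χ₁ (B.sFun y + -t) ≤ D.χ₁ (B.sFun y) := by
    apply D.χ₁.antitone_abs
    rw [abs_of_nonpos hs0, abs_of_nonpos (by linarith)]
    linarith
  have hc : 0 ≤ D.χ₂ (B.rFun y) * |B.rFun y| := D.χ₂_mul_abs_nonneg _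
  have hθy : D.θ y = D.χ₁ (B.sFun y) * (D.χ₂ (B.rFun y) * |B.rFun y|) := rfl
  rw [hθy] at hF
  have hκ := D.κ_pos
  nlinarith [mul_le_mul_of_nonneg_right hχ hc]

/-- **The bevelled sector is preconnected when `{f ≤ cLow}` is**: every point of the sector
flows down (along `-U.ξ`, staying in the sector) into `{f ≤ cLow}`.
[cite: GayKirby2016, §4, Lemma 14] -/
theorem isPreconnected_sector (hL : IsPreconnected (B.f ⁻¹' Iic D.cLow)) : IsPreconnected D.sector := by
  -- the downward orbit segment from a point of the sector into `{f ≤ cLow}`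
  have key : ∀ z ∈ D.sector, ∃ A : Set X, A ⊆ D.sector ∧ z ∈ A ∧ IsPreconnected A ∧
      (A ∩ B.f ⁻¹' Iic D.cLow).Nonempty := by
    intro z hz
    by_cases hzL : B.f z ≤ D.cLow
    · exact ⟨{z}, by simpa using hz, mem_singleton z, isPreconnected_singleton, ⟨z, mem_singleton z, hzL⟩⟩
    · -- `z` is in the band: `cLow < f z ≤ a`
      have hfz : D.cLow < B.f z := not_le.1 hzL
      have hsz : B.sFun z ≤ 0 := D.sFun_nonpos_of_mem_sector hz
      have h1 := D.sub_lt_cLow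
      have h2 : B.f z = B.a + B.sFun z := B.f_eq_add_sFun z
      have hδ := B.U.δ_pos
      have hzU : z ∈ B.U.band := by
        rw [LevelUnitField.mem_band_iff]
        exact ⟨by linarith, by linarith⟩
      set T : ℝ := B.f z - D.cLow with hT
      have hT0 : 0 ≤ T := by rw [hT]; linarith
      refine ⟨(fun t => B.U.fl z (-t)) '' Icc 0 T, ?_, ⟨0, ⟨le_rfl, hT0⟩, by simp⟩, ?_, ?_⟩
      · rintro _ ⟨t, ⟨ht0, htT⟩, rfl⟩
        apply D.fl_neg_mem_sector hz hzU ht0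
        rw [hT] at htT
        exact ⟨by linarith, by linarith⟩
      · exact (isPreconnected_Icc.image _ ((B.U.continuous_fl.comp
          (continuous_const.prodMk continuous_neg)).continuousOn))
      · refine ⟨B.U.fl z (-T), ⟨T, ⟨hT0, le_rfl⟩, rfl⟩, ?_⟩
        show B.f (B.U.fl z (-T)) ≤ D.cLow
        rw [B.U.apply_fl_eq_add hzU ⟨by rw [hT]; linarith, by rw [hT]; linarith⟩, hT]
        linarith
  apply isPreconnected_of_forall_pair
  intro x hx y hy
  obtain ⟨A, hA, hxA, hAc, ⟨a₁, ha₁A, ha₁L⟩⟩ := key x hx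
  obtain ⟨A', hA', hyA', hA'c, ⟨a₂, ha₂A', ha₂L⟩⟩ := key y hy
  refine ⟨A ∪ B.f ⁻¹' Iic D.cLow ∪ A', ?_, Or.inl (Or.inl hxA), Or.inr hyA', ?_⟩
  · exact union_subset (union_subset hA D.preimage_Iic_cLow_subset) hA'
  · exact (hAc.union a₁ ha₁A ha₁L hL).union a₂ (Or.inr ha₂L) ha₂A' hA'c

/-- **The bevelled sector is connected when `{f ≤ cLow}` is connected** (e.g. for a Morse
function with a single critical point of index `0`, `isConnected_preimage_Iic`).
[cite: GayKirby2016, §4, Lemma 14] -/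
theorem connectedSpace_sector (hL : IsConnected (B.f ⁻¹' Iic D.cLow)) : ConnectedSpace D.sector :=
  isConnected_iff_connectedSpace.1
    ⟨hL.nonempty.mono D.preimage_Iic_cLow_subset, D.isPreconnected_sector hL.isPreconnected⟩

end BevelData

end BiCollar

end Literature.Topology.FourManifolds

end
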